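import Literature.IUT.HodgeArakelov.PlusMinusTowerPiVIndex
import Mathlib.GroupTheory.SpecificGroups.Cyclic

/-!
# [IUTchII] Def. 2.3 (i): the quotients `Δ̂^±_v/Δ̂_v`, `Π^±_v/Π_v`, `Π^tp_X̲/Π^tp_X̲̲` are `≅ ℤ/lℤ`

S. Mochizuki, *Inter-universal Teichmüller theory II*, kurims manuscript (Dec. 2020), §2, Def. 2.3 (i) p. 67 ("natural isomorphisms
`… ⥲ Π^±_v/Π_v ⥲ Δ̂^±_v/Δ̂_v ⥲ Gal(X̲̲_v/X̲_v) (≅ ℤ/lℤ)`") ([IUTchII] Def 2.3 (i), kurims p.67) [claim: Mochizuki2012, status: disputed] (D-0012 claim key;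
series status DISPUTED — elementary group theory: a normal subgroup of prime index `l` has cyclic quotient `≅ ℤ/lℤ`; nothing of the series is asserted).
abc-iut cell, seat abc-iut-L6-t19 gen 5 (B14 follow-up).  PROOF-ONLY (0 defs).

* (private helper) `H ⊴ G` of prime index `l` ⇒ `G/H ≅ ℤ/lℤ` (Mathlib `mulEquivOfPrimeCardEq`);
* **`PlusMinusTower.nonempty_deltaPmHat_quotient_deltaHat`** — for EVERY `±`-tower of abc-iut-L6-t1 (any setting): `Δ̂^±_v/Δ̂_v ≅ ℤ/lℤ`, from the
  fields `deltaHat_normal`, `deltaHat_index` and `l` prime (the setting's `l_prime`);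
* `nonempty_GtpXu_quotient_Huu` — at the [EtTh] tempered level: `Π^tp_X̲/Π^tp_X̲̲ ≅ ℤ/lℤ` given the arithmetic normality hN (abc-iut-L2-t8's
  `relIndex_Huu_GtpXu = l`) — print's `Gal(X̲̲_v/X̲_v) ≅ ℤ/lℤ`;
* `PlusMinusTower.nonempty_piPM_quotient_piV` / **`…_ofUnderline`** — for EVERY tower over a setting with `[Π^tp_{X_v} : inclPlain Π_v] = l` /
  over the print-level model `BadPlaceSetting.ofUnderline`: `Π^±_v/Π_v ≅ ℤ/lℤ` (index p429377; the normality INSTANCE the quotient needs is p429966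
  `piV_subgroupOf_piPM_normal_ofUnderline … hN`, unconditional for abc-iut-L2-t7's cocycle model under `μ_l ⊆ K`).
Quotients need `Normal` as an INSTANCE, so the normalities enter as instance binders supplied by the named theorems / the field `deltaHat_normal`.

Nothing here takes a side on [IUTchIII] Cor. 3.12; typed ≠ proved.
-/

/-- **A normal subgroup of prime index `l` has quotient `≅ ℤ/lℤ`** (both are groups of prime order `l`; Mathlib `mulEquivOfPrimeCardEq`). [folklore] -/
private theorem Subgroup.nonempty_quotient_mulEquiv_zmod_of_index_prime {G : Type*} [Group G] (H : Subgroup G) [H.Normal] {l : ℕ}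
    (hl : l.Prime) (h : H.index = l) : Nonempty (G ⧸ H ≃* Multiplicative (ZMod l)) := by
  haveI : Fact l.Prime := ⟨hl⟩
  refine ⟨mulEquivOfPrimeCardEq (p := l) ?_ ?_⟩
  · rw [← Subgroup.index_eq_card, h]
  · exact Nat.card_zmod l

namespace Literature.IUT.HodgeArakelov

open Literature.AnabelianGeometry.EtaleTheta

universe u

namespace PlusMinusTower

variable {S : BadPlaceSetting.{u}} {P : TopGroup.{u}} {T : TemperedCoverings S P} (W : PlusMinusTower T)

/-- **`Δ̂^±_v/Δ̂_v ≅ ℤ/lℤ` for EVERY `±`-tower** (field `deltaHat_index`; `l` prime by the setting's `l_prime`); the normality instance the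
quotient needs is the field `W.deltaHat_normal` (`haveI := W.deltaHat_normal` at the call site).  PROVED.
([IUTchII] Def 2.3 (i), kurims p.67) [claim: Mochizuki2012, status: disputed] -/
theorem nonempty_deltaPmHat_quotient_deltaHat [((W.hat ⊓ W.aug.ker).subgroupOf (W.pmHat ⊓ W.aug.ker)).Normal] :
    Nonempty (↥(W.pmHat ⊓ W.aug.ker) ⧸ (W.hat ⊓ W.aug.ker).subgroupOf (W.pmHat ⊓ W.aug.ker) ≃* Multiplicative (ZMod S.l)) :=
  Subgroup.nonempty_quotient_mulEquiv_zmod_of_index_prime _ S.l_prime W.deltaHat_index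

/-- **`Π^±_v/Π_v ≅ ℤ/lℤ` for EVERY `±`-tower over a setting with `[Π^tp_{X_v} : inclPlain Π_v] = l` prime** (index: p429377
`index_piV_subgroupOf_piPM_eq`); the normality instance is `piV_subgroupOf_piPM_normal_of_setting` (p429966) from `inclPlain Π_v ⊴ Π^tp_{X_v}`.
PROVED. ([IUTchII] Def 2.3 (i), kurims p.67) [claim: Mochizuki2012, status: disputed] -/
theorem nonempty_piPM_quotient_piV [(W.piV.subgroupOf W.piPM).Normal] {l : ℕ} (hl : l.Prime) (hidx : S.inclPlain.range.index = l) :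
    Nonempty (↥W.piPM ⧸ W.piV.subgroupOf W.piPM ≃* Multiplicative (ZMod l)) :=
  Subgroup.nonempty_quotient_mulEquiv_zmod_of_index_prime _ hl (W.index_piV_subgroupOf_piPM_eq.trans hidx)

end PlusMinusTower

/-! ## The [EtTh] models -/

section Models

variable {p : ℕ} [Fact p.Prime] {D : Literature.AnabelianGeometry.EtaleTheta.ThetaSetting p} {E : D.EtaleThetaData} {l : ℕ}
  (C : E.DoubleUnderline l)

/-- **`Π^tp_X̲/Π^tp_X̲̲ ≅ ℤ/lℤ`** at the tempered level (print's `Gal(X̲̲_v/X̲_v) ≅ ℤ/lℤ`), given the arithmetic normality hN (instance binder; abc-iut-L2-t7's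
`doubleUnderline_normal_of_muL` for the cocycle model) and `l` prime (abc-iut-L2-t8's `relIndex_Huu_GtpXu = l`).  PROVED. ([IUTchII] Def 2.3 (i), kurims p.67) [claim: Mochizuki2012, status: disputed] -/
theorem nonempty_GtpXu_quotient_Huu (hl : l.Prime) [(C.Huu.subgroupOf (D.GtpXu l)).Normal] :
    Nonempty (↥(D.GtpXu l) ⧸ C.Huu.subgroupOf (D.GtpXu l) ≃* Multiplicative (ZMod l)) :=
  Subgroup.nonempty_quotient_mulEquiv_zmod_of_index_prime _ hl C.relIndex_Huu_GtpXu

variable {N : ℕ+} (μ : D.CyclotomeMod l N) (hC : D.Compat) (hS : D.Sec2Hyps) (hl : l.Prime) (hp2 : p ≠ 2) (hpl : p ≠ l)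
  (hζ : ∃ ζ : D.K, IsPrimitiveRoot ζ (4 * l)) {η : (C.thetaEnvData μ hC hS).PiYdd → MuN p N}
  (hη : η ∈ (C.thetaEnvData μ hC hS).thetaCocycles)

/-- **`Π^±_v/Π_v ≅ ℤ/lℤ` for EVERY tower over the print-level model** (index: `ofUnderline_index_eq`); the normality instance is p429966
`piV_subgroupOf_piPM_normal_ofUnderline … hN` (or `…_ofCocycle` for abc-iut-L2-t7's cocycle model, unconditional under `μ_l ⊆ K`).  PROVED. ([IUTchII] Def 2.3 (i), kurims p.67) [claim: Mochizuki2012, status: disputed] -/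
theorem PlusMinusTower.nonempty_piPM_quotient_piV_ofUnderline {P : TopGroup.{0}}
    {T : TemperedCoverings (BadPlaceSetting.ofUnderline C μ hC hS hl hp2 hpl hζ hη) P} (W : PlusMinusTower T)
    [(W.piV.subgroupOf W.piPM).Normal] :
    Nonempty (↥W.piPM ⧸ W.piV.subgroupOf W.piPM ≃* Multiplicative (ZMod l)) :=
  W.nonempty_piPM_quotient_piV hl (BadPlaceSetting.ofUnderline_index_eq C μ hC hS hl hp2 hpl hζ hη)

end Models

end Literature.IUT.HodgeArakelov
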